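/-
Copyright (c) 2026 the pub-hodgecm-mathlib formalisation cell (harness21).  Prover seat hodgecm-mathlib-K2E3-p06 (g2), Track B «K2-LIT» ∕ h413,
ENGINE E3 unit U4 «Keys», SIGS-TABLE row #6 `sig_K2E3IrregularReducibleCaseThree` — analytic letter hKP, brick F2 (the skew-line integrand is integrable).
-/
import Literature.NumberTheory.Automorphic.InvolutionRingFixedDecomposition   -- ★ `fixedPart ∕ skewPart ∕ smulSkew ∕ skewModulus`, `χ⁻(l)² = ‖l‖`
import Literature.NumberTheory.Automorphic.LocalFieldHaarBalls                -- ★ balls `𝔭^n`, `continuous_normAbs`, `addHaar_smul_set`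
import Literature.NumberTheory.Automorphic.AddCharConductorExponent           -- ★ `normAbs_add_le_max`, `normAbs_neg`
import Mathlib.MeasureTheory.Integral.DominatedConvergence
import HarnessLib

/-!
# K2 · E3 · U4 «Keys», row #6 — brick F2: on a non-archimedean local field `E` with a continuous involution `σ` (`2 ∈ Eˣ`), the skew-line integrand
# `η ↦ ‖1+η‖⁻¹ • D(1+η)` (`D` bounded measurable) is INTEGRABLE on `E⁻ = {σ η = −η}`, and its ball truncations converge to the full integral [Keys1984 §5; Tate1950 §2.2]

Cell `pub/hodgecm-mathlib` (D-0151), HCML Track B «K2-LIT», crux H413 = `stmt-HodgeConjecture-24833` (lane `--supports … --as helper`), route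
HCCMUnconditional; socket `sig_K2E3IrregularReducibleCaseThree` (U4-c) of `Cruxes/H413/Lines/K2_E3_EllipticInputsSigs_U4Keys.lean`.
THEOREMS ONLY (0 def ∕ 0 instance ∕ 0 notation ∕ 0 sorry); ★ Literature imports only.

FRAME (that of ★ `InvolutionRingFixedDecomposition`, specialised to a FIELD): `E` a non-archimedean local field (Mathlib `IsNonarchimedeanLocalField`),
`σ : E →+* E` a continuous involution with `‖σ x‖ = ‖x‖` (`‖·‖ = normAbs E`), `[Invertible (2 : E)]`; `E⁺ = fixedPart σ`, `E⁻ = skewPart σ`; `μ⁻` a regular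
additive Haar measure of `E⁻`.  For `E = L_w` at a non-split place this is the `R = L ⊗ L⁺_v`, `R⁻` of row #6 (one place), transported in brick F6.
WHY.  The analytic letter hKP of row #6 asserts `J = ∫_{E⁻} ‖1+η‖⁻¹ • χ₁(1+η) dμ⁻ ≠ 0`; as a Bochner integral this presupposes (and the proof by Tate's
Fubini trick at `s = 0`, bricks F1 ∕ F3–F5, uses) the absolute convergence of `J` and the convergence of its ball truncations `J(T) = ∫_{‖η‖ ≤ T}`.
* §1 `one_add_ne_zero_of_mem_skewPart` (`1 + η ≠ 0`: else `σ(−1) = 1`, `2 = 0`), **`normAbs_le_half_mul_of_fixed ∕ _of_skew`** (`‖a‖, ‖y‖ ≤ ‖½‖ ‖a + y‖` for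
  `a ∈ E⁺`, `y ∈ E⁻`: `a = ½((a+y) + σ(a+y))`, ultrametric), hence **`normAbs_two_le_normAbs_one_add`**, **`normAbs_two_mul_le_normAbs_one_add`**:
  `‖1+η‖ ≥ ‖2‖ · max(1, ‖η‖)` on `E⁻` — the uniform lower bound replacing any case analysis by ramification (dyadic places included);
* §2 `exists_fixed_one_lt_normAbs` (a `σ`-fixed `l` with `‖l‖ > 1`), `distribHaarChar_eq_normAbs'`, **`measure_skewBall_le_eq`** (`μ⁻{‖η‖ ≤ ‖l‖ r} = χ⁻(l) μ⁻{‖η‖ ≤ r}`),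
  `measure_skewBall_pow` (`μ⁻{‖η‖ ≤ ‖l‖^j} = χ⁻(l)^j μ⁻{‖η‖ ≤ 1}`), `one_lt_skewModulus` ∕ `skewModulus_lt_normAbs` (`1 < χ⁻(l) = √‖l‖ < ‖l‖`);
* §3 **`integrable_inv_normAbs_smul_skewPart`** — `η ↦ ‖1+η‖⁻¹ • D(1+η)` is `μ⁻`-integrable for every bounded measurable `D : E → ℂ` (shells `‖l‖^k ≤ ‖η‖ < ‖l‖^{k+1}`
  have mass `≤ χ⁻(l)^{k+1} μ⁻(ball)` and carry `‖2‖⁻¹ ‖l‖^{−k}`: a geometric series of ratio `χ⁻(l)/‖l‖ < 1`);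
* §4 **`tendsto_integral_indicator_skewBall`** — `∫ 𝟙_{‖η‖ ≤ T_k} F dμ⁻ → ∫ F dμ⁻` for `T_k → ∞` (dominated convergence), and `norm_integral_indicator_le`.
HONEST LABEL: HC_CM is proved only modulo the 7 printed citations (2 remaining named inputs: hLiu418 = `stmt-HodgeConjecture-24832`, h413 =
`stmt-HodgeConjecture-24833`) until rung 0 closes; count-neutral analytic plumbing (no socket paid here).

## References
* [Keys1984] D. Keys, *Principal series representations of special unitary groups over local fields*, Compositio Math. 51 (1984), §5 (Plancherel measure; the
  rank-one intertwining integral over the skew line).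
* [Tate1950] J. Tate, *Fourier analysis in number fields and Hecke's zeta-functions* (1950), §2.2 (the module `‖·‖`, Lemma 2.2.5 `d(ax) = ‖a‖dx`).
* [WeilBNT1967] A. Weil, *Basic Number Theory* (1967), Ch. I §2 (module of an automorphism), Ch. II §5.
-/

set_option autoImplicit false
-- the mandated namespace has the single-problem summit's repeated segment (`HodgeConjecture.HodgeConjecture`)
set_option linter.dupNamespace false

noncomputable section

open scoped NNReal ENNReal Topology Pointwise
open MeasureTheory Filter Set
open Literature.NumberTheory.GaloisRepresentations.IsNonarchimedeanLocalField
open Literature.NumberTheory.Automorphic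
open Literature.NumberTheory.Automorphic.UnitaryGroup.HeisRing

namespace Summit.HodgeConjecture.HodgeConjecture.Cruxes.H413.K2E3SkewLineIntegrable

variable {E : Type*} [Field E] [ValuativeRel E] [TopologicalSpace E] [IsNonarchimedeanLocalField E]
  (σ : E →+* E) (hσ : ∀ x, σ (σ x) = x) (hσc : Continuous σ) [Invertible (2 : E)]
  (hσn : ∀ x, normAbs E (σ x) = normAbs E x)

/-! ## §1 `1 + E⁻ ⊆ Eˣ` and the uniform lower bound `‖1+η‖ ≥ ‖2‖ · max(1, ‖η‖)` -/

section Algebra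

omit [ValuativeRel E] [TopologicalSpace E] [IsNonarchimedeanLocalField E] in
/-- **`1 + η ≠ 0` for `η ∈ E⁻`**: otherwise `η = −1` is `σ`-fixed and `σ`-skew, so `2 = 0`, contradicting `2 ∈ Eˣ`. [cite: Keys1984, §5] -/
theorem one_add_ne_zero_of_mem_skewPart {η : E} (hη : η ∈ skewPart σ) : 1 + η ≠ 0 := by
  intro h
  have h1 : η = -1 := eq_neg_of_add_eq_zero_right h
  have h2 : σ η = -η := (mem_skewPart_iff σ η).1 hη
  rw [h1, map_neg, map_one, neg_neg] at h2
  have h3 : (2 : E) = 0 := by linear_combination -h2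
  exact (Invertible.ne_zero (2 : E)) h3

omit [ValuativeRel E] [TopologicalSpace E] [IsNonarchimedeanLocalField E] in
/-- `1 + η` is a unit for `η ∈ E⁻`. [cite: Keys1984, §5] -/
theorem isUnit_one_add_of_mem_skewPart {η : E} (hη : η ∈ skewPart σ) : IsUnit (1 + η) :=
  isUnit_iff_ne_zero.2 (one_add_ne_zero_of_mem_skewPart σ hη)

/-- `‖½‖ · ‖2‖ = 1`. [folklore] -/
theorem normAbs_invOf_two_mul_normAbs_two : normAbs E (⅟(2 : E)) * normAbs E 2 = 1 := by
  rw [← map_mul, invOf_mul_self, map_one]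

/-- `‖2‖ > 0`. [folklore] -/
theorem normAbs_two_pos : 0 < normAbs E (2 : E) :=
  pos_iff_ne_zero.2 ((map_ne_zero (normAbs E)).2 (Invertible.ne_zero (2 : E)))

include hσn in
/-- **`‖a‖ ≤ ‖½‖ · ‖a + y‖`** for `a` fixed and `y` skew: `a = ½((a+y) + σ(a+y))`, the ultrametric inequality and `‖σ ·‖ = ‖·‖`. [cite: WeilBNT1967, Ch. I §2] -/
theorem normAbs_le_half_mul_of_fixed {a y : E} (ha : σ a = a) (hy : σ y = -y) :
    normAbs E a ≤ normAbs E (⅟(2 : E)) * normAbs E (a + y) := by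
  have h2 : (⅟(2 : E)) * 2 = 1 := invOf_mul_self _
  have h : a = ⅟(2 : E) * ((a + y) + σ (a + y)) := by
    rw [map_add, ha, hy]; linear_combination (-a) * h2
  calc normAbs E a = normAbs E (⅟(2 : E)) * normAbs E ((a + y) + σ (a + y)) := by rw [← map_mul, ← h]
    _ ≤ normAbs E (⅟(2 : E)) * normAbs E (a + y) := by
        refine mul_le_mul_of_nonneg_left ((normAbs_add_le_max _ _).trans ?_) zero_le
        rw [hσn, max_self]

include hσn in
/-- **`‖y‖ ≤ ‖½‖ · ‖a + y‖`** for `a` fixed and `y` skew: `y = ½((a+y) − σ(a+y))`. [cite: WeilBNT1967, Ch. I §2] -/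
theorem normAbs_le_half_mul_of_skew {a y : E} (ha : σ a = a) (hy : σ y = -y) :
    normAbs E y ≤ normAbs E (⅟(2 : E)) * normAbs E (a + y) := by
  have h2 : (⅟(2 : E)) * 2 = 1 := invOf_mul_self _
  have h : y = ⅟(2 : E) * ((a + y) + -σ (a + y)) := by
    rw [map_add, ha, hy]; linear_combination (-y) * h2
  calc normAbs E y = normAbs E (⅟(2 : E)) * normAbs E ((a + y) + -σ (a + y)) := by rw [← map_mul, ← h]
    _ ≤ normAbs E (⅟(2 : E)) * normAbs E (a + y) := by
        refine mul_le_mul_of_nonneg_left ((normAbs_add_le_max _ _).trans ?_) zero_le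
        rw [normAbs_neg, hσn, max_self]

include hσn in
/-- **`‖2‖ ≤ ‖1 + η‖`** for `η ∈ E⁻` (`a = 1` in `normAbs_le_half_mul_of_fixed`): the integrand `‖1+η‖⁻¹` is bounded by `‖2‖⁻¹` — uniformly in the ramification type.
[cite: Keys1984, §5] -/
theorem normAbs_two_le_normAbs_one_add {η : E} (hη : η ∈ skewPart σ) : normAbs E 2 ≤ normAbs E (1 + η) := by
  have h := normAbs_le_half_mul_of_fixed σ hσn (map_one σ) ((mem_skewPart_iff σ η).1 hη)
  rw [map_one] at h
  calc normAbs E 2 = normAbs E 2 * 1 := (mul_one _).symm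
    _ ≤ normAbs E 2 * (normAbs E (⅟(2 : E)) * normAbs E (1 + η)) := mul_le_mul_of_nonneg_left h zero_le
    _ = normAbs E (1 + η) := by rw [← mul_assoc, mul_comm (normAbs E 2), normAbs_invOf_two_mul_normAbs_two, one_mul]

include hσn in
/-- **`‖2‖ · ‖η‖ ≤ ‖1 + η‖`** for `η ∈ E⁻` (`y = η` in `normAbs_le_half_mul_of_skew`): far out the integrand decays like `‖η‖⁻¹`. [cite: Keys1984, §5] -/
theorem normAbs_two_mul_le_normAbs_one_add {η : E} (hη : η ∈ skewPart σ) : normAbs E 2 * normAbs E η ≤ normAbs E (1 + η) := by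
  have h := normAbs_le_half_mul_of_skew σ hσn (map_one σ) ((mem_skewPart_iff σ η).1 hη)
  calc normAbs E 2 * normAbs E η ≤ normAbs E 2 * (normAbs E (⅟(2 : E)) * normAbs E (1 + η)) := mul_le_mul_of_nonneg_left h zero_le
    _ = normAbs E (1 + η) := by rw [← mul_assoc, mul_comm (normAbs E 2), normAbs_invOf_two_mul_normAbs_two, one_mul]

include hσn in
/-- The pointwise bound on the skew-line integrand: `‖1+η‖⁻¹ ≤ ‖2‖⁻¹` and `‖1+η‖⁻¹ ≤ ‖2‖⁻¹ ‖η‖⁻¹` when `‖η‖ ≥ r > 0` — as `‖1+η‖⁻¹ ≤ ‖2‖⁻¹ r⁻¹`.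
[cite: Keys1984, §5] -/
theorem inv_normAbs_one_add_le {η : E} (hη : η ∈ skewPart σ) {r : ℝ≥0} (hr : 0 < r) (hle : r ≤ max 1 (normAbs E η)) :
    (normAbs E (1 + η))⁻¹ ≤ (normAbs E 2)⁻¹ * r⁻¹ := by
  have h2 := normAbs_two_pos (E := E)
  have hlow : normAbs E 2 * r ≤ normAbs E (1 + η) := by
    rcases le_max_iff.1 hle with h | h
    · exact le_trans (mul_le_mul_of_nonneg_left h zero_le) (by rw [mul_one]; exact normAbs_two_le_normAbs_one_add σ hσn hη)
    · exact le_trans (mul_le_mul_of_nonneg_left h zero_le) (normAbs_two_mul_le_normAbs_one_add σ hσn hη)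
  rw [← mul_inv]
  exact inv_anti₀ (mul_pos h2 hr) hlow

end Algebra

/-! ## §2 A fixed unit of large norm; the mass of the balls of `E⁻` scales by `χ⁻(l) = √‖l‖ < ‖l‖` -/

section Scaling

omit [Invertible (2 : E)] in
include hσ hσn in
/-- **A `σ`-fixed element of norm `> 1`**: `l = (ϖ σϖ)⁻¹` for a uniformiser `ϖ`. [cite: WeilBNT1967, Ch. I §2] -/
theorem exists_fixed_one_lt_normAbs : ∃ l : E, σ l = l ∧ 1 < normAbs E l := by
  obtain ⟨ϖ, hϖ0, hϖ⟩ := exists_normAbs_eq_inv (F := E)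
  refine ⟨(ϖ * σ ϖ)⁻¹, by rw [map_inv₀, map_mul, hσ, mul_comm], ?_⟩
  rw [map_inv₀, map_mul, hσn, hϖ, ← mul_inv, inv_inv]
  exact one_lt_mul'' one_lt_residueFieldCard_nnreal one_lt_residueFieldCard_nnreal

variable [MeasurableSpace E] [BorelSpace E]

omit [Invertible (2 : E)] in
/-- **`distribHaarChar E a = ‖a‖`** on a non-archimedean local field (★ `LocalFieldHaar.addHaar_smul_set` on the compact open ball `𝒪 = 𝔭^0`; reproduced from ★
`UnitaryGroup.distribHaarChar_eq_normAbs` to keep the import closure small). [cite: Tate1950, §2.2, Lemma 2.2.5] -/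
theorem distribHaarChar_eq_normAbs' (a : Eˣ) : distribHaarChar E a = normAbs E (a : E) := by
  set μ : Measure E := Measure.addHaar with hμ
  have h1 : μ ((a : E) • primePowBall E 0) = normAbs E (a : E) * μ (primePowBall E 0) := addHaar_smul_set μ a.ne_zero _
  have h2 : μ ((a : E) • primePowBall E 0) = distribHaarChar E a * μ (primePowBall E 0) := by
    rw [show (a : E) • primePowBall E 0 = a • primePowBall E 0 from rfl, distribHaarChar_mul]
  have hpos : μ (primePowBall E 0) ≠ 0 := (addHaar_primePowBall_pos μ 0).ne'
  have hfin : μ (primePowBall E 0) ≠ ⊤ := (measure_primePowBall_lt_top μ 0).ne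
  have h : (distribHaarChar E a : ℝ≥0∞) * μ (primePowBall E 0) = (normAbs E (a : E) : ℝ≥0∞) * μ (primePowBall E 0) := h2.symm.trans h1
  exact ENNReal.coe_inj.1 ((ENNReal.mul_left_inj hpos hfin).1 h)

variable [T2Space E] [SecondCountableTopology E] (μm : Measure (skewPart σ)) [μm.IsAddHaarMeasure] [μm.Regular]

omit [Invertible (2 : E)] [SecondCountableTopology E] in
/-- **`μ⁻{‖η‖ ≤ ‖l‖ · r} = χ⁻(l) · μ⁻{‖η‖ ≤ r}`** for a `σ`-fixed unit `l` (the preimage of the big ball under `η ↦ l η` is the small one; ★ `map_smulSkew_eq`).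
[cite: WeilBNT1967, Ch. I §2] -/
theorem measure_skewBall_le_eq (l : Eˣ) (hl : σ (l : E) = l) (r : ℝ≥0) :
    μm {η : skewPart σ | normAbs E (η : E) ≤ normAbs E (l : E) * r} = skewModulus σ hσc l hl * μm {η : skewPart σ | normAbs E (η : E) ≤ r} := by
  haveI := locallyCompactSpace_skewPart σ hσc
  have hl0 : 0 < normAbs E (l : E) := pos_iff_ne_zero.2 ((map_ne_zero _).2 l.ne_zero)
  have hmeas : ∀ s : ℝ≥0, MeasurableSet {η : skewPart σ | normAbs E (η : E) ≤ s} := fun s =>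
    measurableSet_le (LocalFieldHaar.continuous_normAbs.measurable.comp measurable_subtype_coe) measurable_const
  have hpre : (smulSkew σ l hl) ⁻¹' {η : skewPart σ | normAbs E (η : E) ≤ normAbs E (l : E) * r} = {η : skewPart σ | normAbs E (η : E) ≤ r} := by
    ext η
    simp only [Set.mem_preimage, Set.mem_setOf_eq, coe_smulSkew, map_mul]
    exact ⟨fun h => le_of_mul_le_mul_left h hl0, fun h => mul_le_mul_of_nonneg_left h zero_le⟩
  have hmap := map_smulSkew_eq σ hσc l hl μm
  have hms : Measurable (smulSkew σ l hl : skewPart σ → skewPart σ) := (smulSkew σ l hl).continuous.measurable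
  have h1 : μm {η : skewPart σ | normAbs E (η : E) ≤ r} = ((skewModulus σ hσc l hl)⁻¹ : ℝ≥0) * μm {η : skewPart σ | normAbs E (η : E) ≤ normAbs E (l : E) * r} := by
    rw [← hpre, ← Measure.map_apply hms (hmeas _), hmap, Measure.coe_nnreal_smul_apply]
  have hpos := skewModulus_pos σ hσc l hl
  rw [h1, ← mul_assoc, ← ENNReal.coe_mul, mul_inv_cancel₀ hpos.ne', ENNReal.coe_one, one_mul]

omit [Invertible (2 : E)] [SecondCountableTopology E] in
/-- **`μ⁻{‖η‖ ≤ ‖l‖^j} = χ⁻(l)^j · μ⁻{‖η‖ ≤ 1}`**. [cite: WeilBNT1967, Ch. I §2] -/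
theorem measure_skewBall_pow (l : Eˣ) (hl : σ (l : E) = l) (j : ℕ) :
    μm {η : skewPart σ | normAbs E (η : E) ≤ normAbs E (l : E) ^ j} = skewModulus σ hσc l hl ^ j * μm {η : skewPart σ | normAbs E (η : E) ≤ 1} := by
  induction j with
  | zero => rw [pow_zero, pow_zero, one_mul]
  | succ j ih => rw [pow_succ', measure_skewBall_le_eq σ hσc μm l hl, ih, pow_succ', mul_assoc]

omit [T2Space E] [SecondCountableTopology E] in
include hσ in
/-- **`χ⁻(l) > 1` when `‖l‖ > 1`** (`χ⁻(l)² = ‖l‖`, ★ `skewModulus_mul_self`, needs a `σ`-skew unit `δ`). [cite: WeilBNT1967, Ch. I §2] -/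
theorem one_lt_skewModulus [T2Space E] [SecondCountableTopology E] (δ : Eˣ) (hδ : σ (δ : E) = -δ) (l : Eˣ) (hl : σ (l : E) = l) (hQ : 1 < normAbs E (l : E)) :
    1 < skewModulus σ hσc l hl := by
  have hsq : skewModulus σ hσc l hl * skewModulus σ hσc l hl = normAbs E (l : E) := by
    rw [skewModulus_mul_self σ hσ hσc δ hδ l hl, distribHaarChar_eq_normAbs']
  by_contra h
  push Not at h
  have : normAbs E (l : E) ≤ 1 := by rw [← hsq]; exact mul_le_one' h h
  exact absurd hQ (not_lt.2 this)

omit [T2Space E] [SecondCountableTopology E] in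
include hσ in
/-- **`χ⁻(l) < ‖l‖` when `‖l‖ > 1`** (`χ⁻(l)² = ‖l‖`, ★ `skewModulus_mul_self`, needs a `σ`-skew unit `δ`). [cite: WeilBNT1967, Ch. I §2] -/
theorem skewModulus_lt_normAbs [T2Space E] [SecondCountableTopology E] (δ : Eˣ) (hδ : σ (δ : E) = -δ) (l : Eˣ) (hl : σ (l : E) = l) (hQ : 1 < normAbs E (l : E)) :
    skewModulus σ hσc l hl < normAbs E (l : E) := by
  have hsq : skewModulus σ hσc l hl * skewModulus σ hσc l hl = normAbs E (l : E) := by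
    rw [skewModulus_mul_self σ hσ hσc δ hδ l hl, distribHaarChar_eq_normAbs']
  have h1 : 1 < skewModulus σ hσc l hl := one_lt_skewModulus σ hσ hσc δ hδ l hl hQ
  calc skewModulus σ hσc l hl = skewModulus σ hσc l hl * 1 := (mul_one _).symm
    _ < skewModulus σ hσc l hl * skewModulus σ hσc l hl := mul_lt_mul_of_pos_left h1 (lt_trans zero_lt_one h1)
    _ = normAbs E (l : E) := hsq

omit [Invertible (2 : E)] [SecondCountableTopology E] [μm.IsAddHaarMeasure] [μm.Regular] [BorelSpace E] in
include hσc in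
/-- The unit ball of `E⁻` is compact (a closed subset of the compact `𝒪_E`), hence of finite `μ⁻`-mass. [cite: WeilBNT1967, Ch. II §5] -/
theorem measure_skewBall_one_lt_top [IsFiniteMeasureOnCompacts μm] : μm {η : skewPart σ | normAbs E (η : E) ≤ 1} < ⊤ := by
  have h : {η : skewPart σ | normAbs E (η : E) ≤ 1} = (Subtype.val : skewPart σ → E) ⁻¹' primePowBall E 0 := by
    ext η; simp only [Set.mem_setOf_eq, Set.mem_preimage, mem_primePowBall_iff, zpow_zero]
  rw [h]
  exact ((isClosed_skewPart σ hσc).isClosedEmbedding_subtypeVal.isCompact_preimage (isCompact_primePowBall 0)).measure_lt_top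

end Scaling

/-! ## §3 Integrability of `η ↦ ‖1+η‖⁻¹ • D(1+η)` on `E⁻` -/

section Integrable

variable [MeasurableSpace E] [BorelSpace E] [T2Space E] [SecondCountableTopology E]
  (μm : Measure (skewPart σ)) [μm.IsAddHaarMeasure] [μm.Regular]

include hσ hσc hσn in
/-- **THE SKEW-LINE INTEGRAND IS INTEGRABLE.**  For a bounded measurable `D : E → ℂ` (`‖D b‖ ≤ C`), `η ↦ ‖1+η‖⁻¹ • D(1+η)` is integrable on `E⁻` for every regular Haar
`μ⁻`: with a `σ`-fixed unit `l` of norm `Q > 1` and module `m = χ⁻(l) = √Q`, the ball `{‖η‖ < 1}` carries `≤ C‖2‖⁻¹ · μ⁻{‖η‖ ≤ 1}` and the shell `{Q^k ≤ ‖η‖ < Q^{k+1}}`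
carries `≤ C‖2‖⁻¹ Q^{−k} · m^{k+1} μ⁻{‖η‖ ≤ 1}` (§1, §2) — a geometric series of ratio `m/Q < 1`.  A `σ`-skew unit `δ` is needed for `χ⁻(l)² = ‖l‖`.
[cite: Keys1984, §5] [cite: Tate1950, §2.2, Lemma 2.2.5] -/
theorem integrable_inv_normAbs_smul_skewPart (δ : Eˣ) (hδ : σ (δ : E) = -δ)
    (D : E → ℂ) (hDm : Measurable D) {C : ℝ} (hDb : ∀ b, ‖D b‖ ≤ C) :
    Integrable (fun η : skewPart σ => (((normAbs E (1 + (η : E)))⁻¹ : ℝ≥0)) • D (1 + (η : E))) μm := by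
  haveI := locallyCompactSpace_skewPart σ hσc
  -- the fixed unit `l` of norm `Q > 1`, its module `m < Q`
  obtain ⟨l₀, hl₀, hQ₀⟩ := exists_fixed_one_lt_normAbs σ hσ hσn
  have hl₀0 : l₀ ≠ 0 := fun h => by rw [h, map_zero] at hQ₀; exact not_lt_of_ge zero_le_one hQ₀
  set l : Eˣ := Units.mk0 l₀ hl₀0 with hldef
  have hl : σ (l : E) = l := hl₀
  set Q : ℝ≥0 := normAbs E (l : E) with hQdef
  have hQ : 1 < Q := hQ₀
  have hQ0 : 0 < Q := lt_trans zero_lt_one hQ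
  set m : ℝ≥0 := skewModulus σ hσc l hl with hmdef
  have hmQ : m < Q := skewModulus_lt_normAbs σ hσ hσc δ hδ l hl hQ
  have hC : 0 ≤ C := le_trans (norm_nonneg _) (hDb 0)
  -- measurability
  have hnc : Continuous fun η : skewPart σ => normAbs E (1 + (η : E)) :=
    LocalFieldHaar.continuous_normAbs.comp (continuous_const.add continuous_subtype_val)
  have hn0 : Continuous fun η : skewPart σ => normAbs E (η : E) := LocalFieldHaar.continuous_normAbs.comp continuous_subtype_val
  have hFm : Measurable (fun η : skewPart σ => (((normAbs E (1 + (η : E)))⁻¹ : ℝ≥0)) • D (1 + (η : E))) :=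
    (hnc.measurable.inv.coe_nnreal_real).smul (hDm.comp (measurable_const.add measurable_subtype_coe))
  refine ⟨hFm.aestronglyMeasurable, ?_⟩
  -- the pointwise bound on a shell `r ≤ max 1 ‖η‖`: `‖F η‖ₑ ≤ K r⁻¹`, `K = C ‖2‖⁻¹`
  set K : ℝ≥0 := Real.toNNReal C * (normAbs E (2 : E))⁻¹ with hKdef
  have hbound : ∀ (η : skewPart σ) {r : ℝ≥0}, 0 < r → r ≤ max 1 (normAbs E (η : E)) →
      ‖(((normAbs E (1 + (η : E)))⁻¹ : ℝ≥0)) • D (1 + (η : E))‖ₑ ≤ ((K * r⁻¹ : ℝ≥0) : ℝ≥0∞) := by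
    intro η r hr hle
    have h1 := inv_normAbs_one_add_le σ hσn η.2 hr hle
    have hD := hDb (1 + (η : E))
    rw [enorm_le_coe, ← NNReal.coe_le_coe, coe_nnnorm, NNReal.smul_def, norm_smul, Real.norm_of_nonneg (NNReal.coe_nonneg _)]
    calc (((normAbs E (1 + (η : E)))⁻¹ : ℝ≥0) : ℝ) * ‖D (1 + (η : E))‖
        ≤ (((normAbs E 2)⁻¹ * r⁻¹ : ℝ≥0) : ℝ) * C := mul_le_mul (by exact_mod_cast h1) hD (norm_nonneg _) (NNReal.coe_nonneg _)
      _ = ((K * r⁻¹ : ℝ≥0) : ℝ) := by rw [hKdef]; push_cast; rw [Real.coe_toNNReal C hC]; ring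
  -- the sets: the ball `B = {‖η‖ < 1}` and the shells `A k = {Q^k ≤ ‖η‖ < Q^{k+1}}`
  set B : Set (skewPart σ) := {η | normAbs E (η : E) < 1} with hBdef
  set A : ℕ → Set (skewPart σ) := fun k => {η | Q ^ k ≤ normAbs E (η : E) ∧ normAbs E (η : E) < Q ^ (k + 1)} with hAdef
  set T : Set (skewPart σ) := {η | normAbs E (η : E) ≤ 1} with hTdef
  have hcover : (Set.univ : Set (skewPart σ)) ⊆ B ∪ ⋃ k, A k := by
    intro η _
    by_cases h : normAbs E (η : E) < 1
    · exact Or.inl h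
    · push Not at h
      obtain ⟨n, hn1, hn2⟩ := exists_nat_pow_near (show (1 : ℝ≥0) ≤ normAbs E (η : E) from h) hQ
      exact Or.inr (Set.mem_iUnion.2 ⟨n, hn1, hn2⟩)
  have hTfin : μm T < ⊤ := measure_skewBall_one_lt_top σ hσc μm
  have hBT : μm B ≤ μm T := measure_mono fun η hη => le_of_lt (show normAbs E (η : E) < 1 from hη)
  have hAT : ∀ k, μm (A k) ≤ (m : ℝ≥0∞) ^ (k + 1) * μm T := by
    intro k
    calc μm (A k) ≤ μm {η : skewPart σ | normAbs E (η : E) ≤ normAbs E (l : E) ^ (k + 1)} := measure_mono fun η hη => le_of_lt hη.2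
      _ = (m : ℝ≥0∞) ^ (k + 1) * μm T := by rw [measure_skewBall_pow σ hσc μm l hl (k + 1)]
  -- the lower integral, piece by piece
  have hB : ∫⁻ η in B, ‖(((normAbs E (1 + (η : E)))⁻¹ : ℝ≥0)) • D (1 + (η : E))‖ₑ ∂μm ≤ (K : ℝ≥0∞) * μm T := by
    calc ∫⁻ η in B, ‖(((normAbs E (1 + (η : E)))⁻¹ : ℝ≥0)) • D (1 + (η : E))‖ₑ ∂μm ≤ ∫⁻ _ in B, ((K * (1 : ℝ≥0)⁻¹ : ℝ≥0) : ℝ≥0∞) ∂μm :=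
          lintegral_mono fun η => hbound η zero_lt_one (le_max_left _ _)
      _ = ((K * (1 : ℝ≥0)⁻¹ : ℝ≥0) : ℝ≥0∞) * μm B := by rw [setLIntegral_const]
      _ ≤ (K : ℝ≥0∞) * μm T := by rw [inv_one, mul_one]; exact mul_le_mul_right hBT _
  have hA : ∀ k, ∫⁻ η in A k, ‖(((normAbs E (1 + (η : E)))⁻¹ : ℝ≥0)) • D (1 + (η : E))‖ₑ ∂μm ≤
      ((K * m : ℝ≥0) : ℝ≥0∞) * μm T * ((m * Q⁻¹ : ℝ≥0) : ℝ≥0∞) ^ k := by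
    intro k
    have hQk : 0 < Q ^ k := pow_pos hQ0 k
    have hid : K * (Q ^ k)⁻¹ * m ^ (k + 1) = K * m * (m * Q⁻¹) ^ k := by rw [mul_pow, inv_pow, pow_succ]; ring
    have hmeasA : MeasurableSet (A k) := by
      have : A k = (fun η : skewPart σ => normAbs E (η : E)) ⁻¹' Set.Ico (Q ^ k) (Q ^ (k + 1)) := by
        ext η; simp only [hAdef, Set.mem_setOf_eq, Set.mem_preimage, Set.mem_Ico]
      rw [this]; exact hn0.measurable measurableSet_Ico
    calc ∫⁻ η in A k, ‖(((normAbs E (1 + (η : E)))⁻¹ : ℝ≥0)) • D (1 + (η : E))‖ₑ ∂μm ≤ ∫⁻ _ in A k, ((K * (Q ^ k)⁻¹ : ℝ≥0) : ℝ≥0∞) ∂μm :=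
          setLIntegral_mono measurable_const fun η hη => hbound η hQk (le_trans hη.1 (le_max_right _ _))
      _ = ((K * (Q ^ k)⁻¹ : ℝ≥0) : ℝ≥0∞) * μm (A k) := setLIntegral_const _ _
      _ ≤ ((K * (Q ^ k)⁻¹ : ℝ≥0) : ℝ≥0∞) * ((m : ℝ≥0∞) ^ (k + 1) * μm T) := mul_le_mul_right (hAT k) _
      _ = ((K * m : ℝ≥0) : ℝ≥0∞) * μm T * ((m * Q⁻¹ : ℝ≥0) : ℝ≥0∞) ^ k := by
          rw [← mul_assoc, ← ENNReal.coe_pow, ← ENNReal.coe_mul, hid, ENNReal.coe_mul, ENNReal.coe_pow, mul_right_comm]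
  -- the geometric series converges
  have hρ : ((m * Q⁻¹ : ℝ≥0) : ℝ≥0∞) < 1 := by
    rw [ENNReal.coe_lt_one_iff, mul_inv_lt_iff₀ hQ0, one_mul]
    exact hmQ
  have hsum : ∑' k, ((K * m : ℝ≥0) : ℝ≥0∞) * μm T * ((m * Q⁻¹ : ℝ≥0) : ℝ≥0∞) ^ k < ⊤ := by
    rw [ENNReal.tsum_mul_left, ENNReal.tsum_geometric]
    refine ENNReal.mul_lt_top (ENNReal.mul_lt_top ENNReal.coe_lt_top hTfin) ?_
    rw [ENNReal.inv_lt_top, tsub_pos_iff_lt]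
    exact hρ
  -- assemble
  unfold HasFiniteIntegral
  calc ∫⁻ η, ‖(((normAbs E (1 + (η : E)))⁻¹ : ℝ≥0)) • D (1 + (η : E))‖ₑ ∂μm
      = ∫⁻ η in Set.univ, ‖(((normAbs E (1 + (η : E)))⁻¹ : ℝ≥0)) • D (1 + (η : E))‖ₑ ∂μm := (setLIntegral_univ _).symm
    _ ≤ ∫⁻ η in B ∪ ⋃ k, A k, ‖(((normAbs E (1 + (η : E)))⁻¹ : ℝ≥0)) • D (1 + (η : E))‖ₑ ∂μm := lintegral_mono_set hcover
    _ ≤ ∫⁻ η in B, ‖(((normAbs E (1 + (η : E)))⁻¹ : ℝ≥0)) • D (1 + (η : E))‖ₑ ∂μm +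
          ∫⁻ η in ⋃ k, A k, ‖(((normAbs E (1 + (η : E)))⁻¹ : ℝ≥0)) • D (1 + (η : E))‖ₑ ∂μm := lintegral_union_le _ _ _
    _ ≤ (K : ℝ≥0∞) * μm T + ∑' k, ∫⁻ η in A k, ‖(((normAbs E (1 + (η : E)))⁻¹ : ℝ≥0)) • D (1 + (η : E))‖ₑ ∂μm :=
          add_le_add hB (lintegral_iUnion_le _ _)
    _ ≤ (K : ℝ≥0∞) * μm T + ∑' k, ((K * m : ℝ≥0) : ℝ≥0∞) * μm T * ((m * Q⁻¹ : ℝ≥0) : ℝ≥0∞) ^ k :=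
          add_le_add le_rfl (ENNReal.tsum_le_tsum hA)
    _ < ⊤ := ENNReal.add_lt_top.2 ⟨ENNReal.mul_lt_top ENNReal.coe_lt_top hTfin, hsum⟩

/-! ## §4 Ball truncations converge to the full integral -/

omit [T2Space E] [SecondCountableTopology E] [μm.IsAddHaarMeasure] [μm.Regular] [Invertible (2 : E)] [BorelSpace E] in
omit [ValuativeRel E] [TopologicalSpace E] [IsNonarchimedeanLocalField E] [Invertible (2 : E)] [BorelSpace E]
  [T2Space E] [SecondCountableTopology E] [μm.IsAddHaarMeasure] [μm.Regular] in
/-- `‖∫ 𝟙_S F‖ ≤ ∫ ‖F‖` for an integrable `F` and every set `S`. [folklore] -/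
theorem norm_integral_indicator_le {F : skewPart σ → ℂ} (hF : Integrable F μm) (S : Set (skewPart σ)) :
    ‖∫ η, S.indicator F η ∂μm‖ ≤ ∫ η, ‖F η‖ ∂μm :=
  le_trans (norm_integral_le_integral_norm _) (integral_mono_of_nonneg (Eventually.of_forall fun _ => norm_nonneg _) hF.norm
    (Eventually.of_forall fun η => norm_indicator_le_norm_self F η))

include hσ hσc hσn in
/-- **BALL TRUNCATIONS CONVERGE**: for `T_k → ∞`, `∫ 𝟙_{‖η‖ ≤ T_k} · (‖1+η‖⁻¹ • D(1+η)) dμ⁻ → ∫ ‖1+η‖⁻¹ • D(1+η) dμ⁻` (dominated convergence with the integrable bound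
of §3). [cite: Keys1984, §5] [cite: Tate1950, §2.2] -/
theorem tendsto_integral_indicator_skewBall (δ : Eˣ) (hδ : σ (δ : E) = -δ)
    (D : E → ℂ) (hDm : Measurable D) {C : ℝ} (hDb : ∀ b, ‖D b‖ ≤ C) (T : ℕ → ℝ≥0) (hT : Tendsto T atTop atTop) :
    Tendsto (fun k => ∫ η, ({η : skewPart σ | normAbs E (η : E) ≤ T k}.indicator
        (fun η : skewPart σ => (((normAbs E (1 + (η : E)))⁻¹ : ℝ≥0)) • D (1 + (η : E)))) η ∂μm) atTop
      (𝓝 (∫ η, (((normAbs E (1 + ((η : skewPart σ) : E)))⁻¹ : ℝ≥0)) • D (1 + (η : E)) ∂μm)) := by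
  have hint := integrable_inv_normAbs_smul_skewPart σ hσ hσc hσn μm δ hδ D hDm hDb
  have hn0 : Continuous fun η : skewPart σ => normAbs E (η : E) := LocalFieldHaar.continuous_normAbs.comp continuous_subtype_val
  have hmeas : ∀ k, MeasurableSet {η : skewPart σ | normAbs E (η : E) ≤ T k} := fun k => measurableSet_le hn0.measurable measurable_const
  refine tendsto_integral_filter_of_dominated_convergence (fun η => ‖(((normAbs E (1 + ((η : skewPart σ) : E)))⁻¹ : ℝ≥0)) • D (1 + (η : E))‖)
    (Eventually.of_forall fun k => (hint.aestronglyMeasurable.indicator (hmeas k))) (Eventually.of_forall fun k => Eventually.of_forall fun η =>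
      norm_indicator_le_norm_self _ η) hint.norm (Eventually.of_forall fun η => ?_)
  have hev : ∀ᶠ k in atTop, ({η : skewPart σ | normAbs E (η : E) ≤ T k}.indicator
      (fun η : skewPart σ => (((normAbs E (1 + (η : E)))⁻¹ : ℝ≥0)) • D (1 + (η : E)))) η =
        (((normAbs E (1 + (η : E)))⁻¹ : ℝ≥0)) • D (1 + (η : E)) := by
    filter_upwards [(tendsto_atTop.1 hT) (normAbs E (η : E))] with k hk
    exact Set.indicator_of_mem (show η ∈ {η : skewPart σ | normAbs E (η : E) ≤ T k} from hk)
      (fun η : skewPart σ => (((normAbs E (1 + (η : E)))⁻¹ : ℝ≥0)) • D (1 + (η : E)))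
  exact (tendsto_congr' hev).2 tendsto_const_nhds

end Integrable

end Summit.HodgeConjecture.HodgeConjecture.Cruxes.H413.K2E3SkewLineIntegrable

end
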